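import Summits.AtomisticToContinuum.HydrodynamicLimit.Theorems.LambertianContactSwapSwapGapRelEntBudget
import Summits.AtomisticToContinuum.HydrodynamicLimit.Theorems.LambertianContactSwapLambertianEulerEntropyBudget
import Summits.AtomisticToContinuum.HydrodynamicLimit.Theorems.LambertianContactSwapLambertianEulerIterate
import Summits.AtomisticToContinuum.HydrodynamicLimit.Theorems.LambertianContactSwapLambertianEulerWindow
import Summits.AtomisticToContinuum.HydrodynamicLimit.Theorems.LambertianContactSwapLambertianEulerMarkov
import HarnessLib

/-!
# `SwapGap` (stmt-AtomisticToContinuum-11850), line `Sketch`: S1 `RelEntSwap` ⟺ S1a ∧ (one-sided likelihood gap)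

Helper file (`--supports`) for the crux `Summit.AtomisticToContinuum.HydrodynamicLimit.Theses.LambertianContactSwap.SwapGap`,
line `Sketch` (entropy relative to the Lambertian law), skeleton v4 (lead c2, cycle 3).  Notation: `P_N` local Gibbs data,
`p_t = (Φ_t)_* P_N`, `q_t = (Λ_t)_* (P_N ⊗ γ^ℕ)`, `G_N = localGibbsLaw σ 1 0 1 N (Φ N)`, `h_t = llr q_t G_N`,
`a_N = [KL(P_N ‖ G_N) − KL(q_t ‖ G_N)]/(N+1) ≥ 0` (Λ-entropy production), `b_N = [∫ h_t dq_t − ∫ h_t dp_t]/(N+1)`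
(likelihood gap), `k_N = KL(p_t ‖ q_t)/(N+1) = a_N + b_N` (exact decomposition, `klDiv_map_flow_map_lambertFlow_decomposition`,
unconditional since the Λ-Liouville invariance landed, p116909).

* `relEntSwap_of_upper`: S1 (`k_N → 0` in `ℝ≥0∞`, pre-shock, with the crux's prefix) from S1a (`a_N → 0` with finiteness)
  and the ONE-SIDED likelihood gap UP (`∀ η > 0`, eventually `b_N ≤ η`): `0 ≤ k_N ≤ a_N + η` eventually.
* `likelihoodGapUpper_of_relEntSwap` (registered sub-goal): UP from S1, since `b_N = k_N − a_N ≤ k_N` (`a_N ≥ 0` is data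
  processing through the independent redraws, `klDiv_lambertFlow_le`, `G_N ⊗ γ^ℕ` being `Λ_t`-invariant by
  `stub_gibbsInvariance`).
Hence, given S1a (a theorem modulo exponential-rate Euler for Λ and dilute self-consistency, `lambdaAdiabaticity_of` p117295 +
`stub_staticBookkeeping` p119962), the registered core stub `stub_likelihoodGapUpper` is EQUIVALENT to c0's `RelEntSwap`.
prover-line-stmt-AtomisticToContinuum-11850-c2-0.
-/

noncomputable section

open MeasureTheory Filter Set Topology InformationTheory
open scoped ENNReal

namespace Summit.AtomisticToContinuum.HydrodynamicLimit.Theorems.LambertianContactSwapSwapGapRelEntSwapOfUpper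

open Literature.Analysis.FluidPDE Literature.MathematicalPhysics.KineticTheory
open Summit.AtomisticToContinuum.HydrodynamicLimit.Theorems
open Summit.AtomisticToContinuum.HydrodynamicLimit.Theorems.LambertianContactSwapSwapGapRelEntBudget
open Summit.AtomisticToContinuum.HydrodynamicLimit.Theorems.LambertianContactSwapLambertianEulerGibbsInvariance
open Summit.AtomisticToContinuum.HydrodynamicLimit.Theorems.LambertianContactSwapLambertianEulerEntropyBudget
open Summit.AtomisticToContinuum.HydrodynamicLimit.Theorems.LambertianContactSwapLambertianEulerWindow
open Summit.AtomisticToContinuum.HydrodynamicLimit.Theorems.LambertianContactSwapLambertianEulerMarkov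
open Summit.AtomisticToContinuum.HydrodynamicLimit.Theorems.LambertianContactSwapLambertianEulerIterate

/-- The `Λ`-invariance of `liouville ⊗ γ^ℕ` (landed as `…SwapGapLiouvilleInvarianceLambda.stub_liouvilleInvarianceLambda`,
p116909; re-derived privately from ITERATE/WINDOW/MARKOV so that this file does not wait for that olean).
[cite: GST2013, Prop. 4.1.1] -/
private theorem liouvilleInvarianceLambda :
    ∀ ε : ℝ, 0 < ε → ε < 2⁻¹ → ∀ (N : ℕ) (t : ℝ), 0 ≤ t →
      ((liouville (Torus.geometry (Fin 3)) N ε).prod (lambertNoise (Fin 3))).map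
          (fun p => lambertFlow (Torus.geometry (Fin 3)) ε p.2 p.1 t) =
        liouville (Torus.geometry (Fin 3)) N ε :=
  fun _ hε hε' _ t ht =>
    (stub_iterateLambda hε hε' (fun hV hδ hr hch => stub_windowLambda hε hV hδ hr hch)
      (fun z s hs _ r hr _ hQ _ hH => stub_markovLambda hε hε' z s hs r hr hQ hH)).1 t ht

/-! ## S1 from S1a and the one-sided likelihood gap -/

/-- **S1 from Λ-adiabaticity and the one-sided likelihood gap** (registered sub-goal `relEntSwap_of_upper`): for
`σ < min (1/2, σ₁, σ₂)` and `t ∈ [0, T)` the exact decomposition writes `k_N := KL(p_t ‖ q_t).toReal/(N+1) = a_N + b_N ≥ 0`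
with `a_N → 0` (S1a) and `b_N ≤ η` eventually for every `η > 0` (UP); hence `0 ≤ k_N ≤ a_N + η` eventually, `k_N → 0`,
and `KL(p_t ‖ q_t) < ∞` converts the real limit into the `ℝ≥0∞` one. [cite: KipnisLandim1999, Ch. 6 §1] -/
theorem relEntSwap_of_upper
    (h1a : ∀ (a₀ θ₀ : T3 → ℝ) (u₀ : T3 → V3), Continuous a₀ → Continuous θ₀ → Continuous u₀ →
      (∀ x, 0 < a₀ x) → (∀ x, 0 < θ₀ x) →
      ∃ σ₀ : ℝ, 0 < σ₀ ∧ ∀ σ : ℝ, 0 < σ → σ < σ₀ →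
        ∀ (T : ℝ) (ρ θ : ℝ → T3 → ℝ) (u : ℝ → T3 → V3), IsHardSphereEulerSolution σ T ρ u θ →
          ∀ Φ : (N : ℕ) → HardSphereFlow (Torus.geometry (Fin 3)) (hsDiameter σ N) (N + 1),
            TendstoHydroFieldsAt (fun N => localGibbsLaw σ a₀ u₀ θ₀ N (Φ N)) Φ ρ u θ 0 →
              ∀ t ∈ Set.Ico 0 T,
                (∀ N : ℕ, klDiv (((localGibbsLaw σ a₀ u₀ θ₀ N (Φ N)).prod (lambertNoise (Fin 3))).map
                    (fun p => lambertFlow (Torus.geometry (Fin 3)) (hsDiameter σ N) p.2 p.1 t))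
                  (localGibbsLaw σ (fun _ => 1) (fun _ => 0) (fun _ => 1) N (Φ N)) ≠ ∞) ∧
                Tendsto (fun N : ℕ =>
                  ((klDiv (localGibbsLaw σ a₀ u₀ θ₀ N (Φ N))
                      (localGibbsLaw σ (fun _ => 1) (fun _ => 0) (fun _ => 1) N (Φ N))).toReal -
                    (klDiv (((localGibbsLaw σ a₀ u₀ θ₀ N (Φ N)).prod (lambertNoise (Fin 3))).map
                        (fun p => lambertFlow (Torus.geometry (Fin 3)) (hsDiameter σ N) p.2 p.1 t))
                      (localGibbsLaw σ (fun _ => 1) (fun _ => 0) (fun _ => 1) N (Φ N))).toReal) /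
                  ((N : ℝ) + 1)) atTop (𝓝 0))
    (h1b : ∀ (a₀ θ₀ : T3 → ℝ) (u₀ : T3 → V3), Continuous a₀ → Continuous θ₀ → Continuous u₀ →
      (∀ x, 0 < a₀ x) → (∀ x, 0 < θ₀ x) →
      ∃ σ₀ : ℝ, 0 < σ₀ ∧ ∀ σ : ℝ, 0 < σ → σ < σ₀ →
        ∀ (T : ℝ) (ρ θ : ℝ → T3 → ℝ) (u : ℝ → T3 → V3), IsHardSphereEulerSolution σ T ρ u θ →
          ∀ Φ : (N : ℕ) → HardSphereFlow (Torus.geometry (Fin 3)) (hsDiameter σ N) (N + 1),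
            TendstoHydroFieldsAt (fun N => localGibbsLaw σ a₀ u₀ θ₀ N (Φ N)) Φ ρ u θ 0 →
              ∀ t ∈ Set.Ico 0 T, ∀ η : ℝ, 0 < η → ∀ᶠ N : ℕ in atTop,
                ((∫ z, llr (((localGibbsLaw σ a₀ u₀ θ₀ N (Φ N)).prod (lambertNoise (Fin 3))).map
                      (fun p => lambertFlow (Torus.geometry (Fin 3)) (hsDiameter σ N) p.2 p.1 t))
                    (localGibbsLaw σ (fun _ => 1) (fun _ => 0) (fun _ => 1) N (Φ N)) z
                    ∂(((localGibbsLaw σ a₀ u₀ θ₀ N (Φ N)).prod (lambertNoise (Fin 3))).map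
                      (fun p => lambertFlow (Torus.geometry (Fin 3)) (hsDiameter σ N) p.2 p.1 t))) -
                  ∫ z, llr (((localGibbsLaw σ a₀ u₀ θ₀ N (Φ N)).prod (lambertNoise (Fin 3))).map
                      (fun p => lambertFlow (Torus.geometry (Fin 3)) (hsDiameter σ N) p.2 p.1 t))
                    (localGibbsLaw σ (fun _ => 1) (fun _ => 0) (fun _ => 1) N (Φ N)) z
                    ∂((localGibbsLaw σ a₀ u₀ θ₀ N (Φ N)).map ((Φ N).flow t))) /
                  ((N : ℝ) + 1) ≤ η) :
    ∀ (a₀ θ₀ : T3 → ℝ) (u₀ : T3 → V3), Continuous a₀ → Continuous θ₀ → Continuous u₀ →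
      (∀ x, 0 < a₀ x) → (∀ x, 0 < θ₀ x) →
      ∃ σ₀ : ℝ, 0 < σ₀ ∧ ∀ σ : ℝ, 0 < σ → σ < σ₀ →
        ∀ (T : ℝ) (ρ θ : ℝ → T3 → ℝ) (u : ℝ → T3 → V3), IsHardSphereEulerSolution σ T ρ u θ →
          ∀ Φ : (N : ℕ) → HardSphereFlow (Torus.geometry (Fin 3)) (hsDiameter σ N) (N + 1),
            TendstoHydroFieldsAt (fun N => localGibbsLaw σ a₀ u₀ θ₀ N (Φ N)) Φ ρ u θ 0 →
              ∀ t ∈ Set.Ico 0 T,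
                Tendsto (fun N : ℕ =>
                  klDiv ((localGibbsLaw σ a₀ u₀ θ₀ N (Φ N)).map ((Φ N).flow t))
                    (((localGibbsLaw σ a₀ u₀ θ₀ N (Φ N)).prod (lambertNoise (Fin 3))).map
                      (fun p => lambertFlow (Torus.geometry (Fin 3)) (hsDiameter σ N) p.2 p.1 t)) /
                  ((N : ℝ≥0∞) + 1)) atTop (𝓝 0) := by
  intro a₀ θ₀ u₀ ha hθ hu ha0 hθ0
  obtain ⟨σ₁, hσ₁, h1a'⟩ := h1a a₀ θ₀ u₀ ha hθ hu ha0 hθ0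
  obtain ⟨σ₂, hσ₂, h1b'⟩ := h1b a₀ θ₀ u₀ ha hθ hu ha0 hθ0
  refine ⟨min 2⁻¹ (min σ₁ σ₂), lt_min (by norm_num) (lt_min hσ₁ hσ₂), ?_⟩
  intro σ hσ hσlt T ρ θ u hE Φ hT0 t ht
  have hσhalf : σ < 2⁻¹ := hσlt.trans_le (min_le_left _ _)
  have hσ₁' : σ < σ₁ := hσlt.trans_le ((min_le_right _ _).trans (min_le_left _ _))
  have hσ₂' : σ < σ₂ := hσlt.trans_le ((min_le_right _ _).trans (min_le_right _ _))
  obtain ⟨-, ha_lim⟩ := h1a' σ hσ hσ₁' T ρ θ u hE Φ hT0 t ht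
  have hb := h1b' σ hσ hσ₂' T ρ θ u hE Φ hT0 t ht
  obtain ⟨A, b, -, -, hdec⟩ := klDiv_map_flow_map_lambertFlow_decomposition
    liouvilleInvarianceLambda ha hθ hu ha0 hθ0 hσ hσhalf
  -- abbreviations for the three real sequences
  set P : (N : ℕ) → Measure (Config (N + 1) (Fin 3) T3) := fun N => localGibbsLaw σ a₀ u₀ θ₀ N (Φ N)
    with hPdef
  set Gr : (N : ℕ) → Measure (Config (N + 1) (Fin 3) T3) :=
    fun N => localGibbsLaw σ (fun _ => (1 : ℝ)) (fun _ => (0 : V3)) (fun _ => (1 : ℝ)) N (Φ N) with hGdef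
  set pt : (N : ℕ) → Measure (Config (N + 1) (Fin 3) T3) := fun N => (P N).map ((Φ N).flow t) with hpdef
  set qt : (N : ℕ) → Measure (Config (N + 1) (Fin 3) T3) := fun N =>
    ((P N).prod (lambertNoise (Fin 3))).map
      (fun p => lambertFlow (Torus.geometry (Fin 3)) (hsDiameter σ N) p.2 p.1 t) with hqdef
  have hfinN : ∀ N : ℕ, klDiv (pt N) (qt N) ≠ ∞ := fun N => (hdec N (Φ N) t ht.1).1
  have hk : ∀ N : ℕ, (klDiv (pt N) (qt N)).toReal / ((N : ℝ) + 1) =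
      ((klDiv (P N) (Gr N)).toReal - (klDiv (qt N) (Gr N)).toReal) / ((N : ℝ) + 1) +
        ((∫ z, llr (qt N) (Gr N) z ∂(qt N)) - ∫ z, llr (qt N) (Gr N) z ∂(pt N)) / ((N : ℝ) + 1) := by
    intro N
    obtain ⟨-, -, -, -, h5, h6, -, -⟩ := hdec N (Φ N) t ht.1
    rw [h5, h6]
    ring
  have hk0 : ∀ N : ℕ, 0 ≤ (klDiv (pt N) (qt N)).toReal / ((N : ℝ) + 1) := fun N =>
    div_nonneg ENNReal.toReal_nonneg (by positivity)
  -- the real sequence tends to `0`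
  have hreal : Tendsto (fun N : ℕ => (klDiv (pt N) (qt N)).toReal / ((N : ℝ) + 1)) atTop (𝓝 0) := by
    rw [Metric.tendsto_atTop]
    intro ε hε
    obtain ⟨N₁, hN₁⟩ := (Metric.tendsto_atTop.1 ha_lim) (ε / 2) (by positivity)
    obtain ⟨N₂, hN₂⟩ := eventually_atTop.1 (hb (ε / 4) (by positivity))
    refine ⟨max N₁ N₂, fun N hN => ?_⟩
    have h1 := hN₁ N (le_of_max_le_left hN)
    have h2 := hN₂ N (le_of_max_le_right hN)
    rw [Real.dist_eq, sub_zero, abs_lt] at h1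
    rw [Real.dist_eq, sub_zero, abs_of_nonneg (hk0 N), hk N]
    linarith [h1.2, h2]
  -- back to `ℝ≥0∞`
  have h := ENNReal.tendsto_ofReal hreal
  rw [ENNReal.ofReal_zero] at h
  refine h.congr fun N => ?_
  have hN : (0 : ℝ) < (N : ℝ) + 1 := by positivity
  rw [ENNReal.ofReal_div_of_pos hN, ENNReal.ofReal_toReal (hfinN N)]
  congr 1
  rw [ENNReal.ofReal_add (by positivity) zero_le_one, ENNReal.ofReal_natCast, ENNReal.ofReal_one]

/-! ## The one-sided likelihood gap from S1 -/

/-- **UP from RelEntSwap**: `b_N = KL(p_t ‖ q_t).toReal/(N+1) − a_N ≤ KL(p_t ‖ q_t).toReal/(N+1)` because the Λ-entropy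
production `a_N = [KL(P_N ‖ G_N) − KL(q_t ‖ G_N)]/(N+1)` is non-negative (data processing through the independent redraws,
`klDiv_lambertFlow_le`, `G_N ⊗ γ^ℕ` being `Λ_t`-invariant), and `KL(p_t ‖ q_t)/(N+1) → 0` in `ℝ≥0∞` with finite terms gives
the real convergence. [folklore] -/
theorem likelihoodGapUpper_of_relEntSwap
    (hS1 : ∀ (a₀ θ₀ : T3 → ℝ) (u₀ : T3 → V3), Continuous a₀ → Continuous θ₀ → Continuous u₀ →
      (∀ x, 0 < a₀ x) → (∀ x, 0 < θ₀ x) →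
      ∃ σ₀ : ℝ, 0 < σ₀ ∧ ∀ σ : ℝ, 0 < σ → σ < σ₀ →
      ∀ (T : ℝ) (ρ θ : ℝ → T3 → ℝ) (u : ℝ → T3 → V3), IsHardSphereEulerSolution σ T ρ u θ →
      ∀ Φ : (N : ℕ) → HardSphereFlow (Torus.geometry (Fin 3)) (hsDiameter σ N) (N + 1),
      TendstoHydroFieldsAt (fun N => localGibbsLaw σ a₀ u₀ θ₀ N (Φ N)) Φ ρ u θ 0 →
      ∀ t ∈ Set.Ico 0 T,
      Tendsto (fun N : ℕ =>
      klDiv ((localGibbsLaw σ a₀ u₀ θ₀ N (Φ N)).map ((Φ N).flow t))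
      (((localGibbsLaw σ a₀ u₀ θ₀ N (Φ N)).prod (lambertNoise (Fin 3))).map
      (fun p => lambertFlow (Torus.geometry (Fin 3)) (hsDiameter σ N) p.2 p.1 t)) /
      ((N : ℝ≥0∞) + 1)) atTop (𝓝 0)) :
    ∀ (a₀ θ₀ : T3 → ℝ) (u₀ : T3 → V3), Continuous a₀ → Continuous θ₀ → Continuous u₀ →
    (∀ x, 0 < a₀ x) → (∀ x, 0 < θ₀ x) →
    ∃ σ₀ : ℝ, 0 < σ₀ ∧ ∀ σ : ℝ, 0 < σ → σ < σ₀ →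
    ∀ (T : ℝ) (ρ θ : ℝ → T3 → ℝ) (u : ℝ → T3 → V3), IsHardSphereEulerSolution σ T ρ u θ →
    ∀ Φ : (N : ℕ) → HardSphereFlow (Torus.geometry (Fin 3)) (hsDiameter σ N) (N + 1),
    TendstoHydroFieldsAt (fun N => localGibbsLaw σ a₀ u₀ θ₀ N (Φ N)) Φ ρ u θ 0 →
    ∀ t ∈ Set.Ico 0 T, ∀ η : ℝ, 0 < η → ∀ᶠ N : ℕ in atTop,
    ((∫ z, llr (((localGibbsLaw σ a₀ u₀ θ₀ N (Φ N)).prod (lambertNoise (Fin 3))).map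
    (fun p => lambertFlow (Torus.geometry (Fin 3)) (hsDiameter σ N) p.2 p.1 t))
    (localGibbsLaw σ (fun _ => 1) (fun _ => 0) (fun _ => 1) N (Φ N)) z
    ∂(((localGibbsLaw σ a₀ u₀ θ₀ N (Φ N)).prod (lambertNoise (Fin 3))).map
    (fun p => lambertFlow (Torus.geometry (Fin 3)) (hsDiameter σ N) p.2 p.1 t))) -
    ∫ z, llr (((localGibbsLaw σ a₀ u₀ θ₀ N (Φ N)).prod (lambertNoise (Fin 3))).map
    (fun p => lambertFlow (Torus.geometry (Fin 3)) (hsDiameter σ N) p.2 p.1 t))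
    (localGibbsLaw σ (fun _ => 1) (fun _ => 0) (fun _ => 1) N (Φ N)) z
    ∂((localGibbsLaw σ a₀ u₀ θ₀ N (Φ N)).map ((Φ N).flow t))) /
    ((N : ℝ) + 1) ≤ η := by
  intro a₀ θ₀ u₀ ha hθ hu ha0 hθ0
  obtain ⟨σ₁, hσ₁, h1⟩ := hS1 a₀ θ₀ u₀ ha hθ hu ha0 hθ0
  refine ⟨min 2⁻¹ σ₁, lt_min (by norm_num) hσ₁, ?_⟩
  intro σ hσ hσlt T ρ θ u hE Φ hT0 t ht η hη
  have hσhalf : σ < 2⁻¹ := hσlt.trans_le (min_le_left _ _)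
  have hσ₁' : σ < σ₁ := hσlt.trans_le (min_le_right _ _)
  have hσ2 : σ ≤ 1 / 2 := by rw [one_div]; exact hσhalf.le
  have hlim := h1 σ hσ hσ₁' T ρ θ u hE Φ hT0 t ht
  obtain ⟨A, b, -, -, hdec⟩ := klDiv_map_flow_map_lambertFlow_decomposition
    liouvilleInvarianceLambda ha hθ hu ha0 hθ0 hσ hσhalf
  set P : (N : ℕ) → Measure (Config (N + 1) (Fin 3) T3) := fun N => localGibbsLaw σ a₀ u₀ θ₀ N (Φ N)
    with hPdef
  set Gr : (N : ℕ) → Measure (Config (N + 1) (Fin 3) T3) :=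
    fun N => localGibbsLaw σ (fun _ => (1 : ℝ)) (fun _ => (0 : V3)) (fun _ => (1 : ℝ)) N (Φ N) with hGdef
  set pt : (N : ℕ) → Measure (Config (N + 1) (Fin 3) T3) := fun N => (P N).map ((Φ N).flow t) with hpdef
  set qt : (N : ℕ) → Measure (Config (N + 1) (Fin 3) T3) := fun N =>
    ((P N).prod (lambertNoise (Fin 3))).map
      (fun p => lambertFlow (Torus.geometry (Fin 3)) (hsDiameter σ N) p.2 p.1 t) with hqdef
  have hΛ : ∀ N, Measurable fun p : Config (N + 1) (Fin 3) T3 × (ℕ → V3) =>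
      lambertFlow (Torus.geometry (Fin 3)) (hsDiameter σ N) p.2 p.1 t :=
    fun N => measurable_lambertFlow_hsDiameter hσ.le hσhalf N t
  have hPN : ∀ N, IsProbabilityMeasure (P N) := fun N =>
    isProbabilityMeasure_localGibbsLaw ha hθ hu ha0 hθ0 hσ2 N (Φ N)
  have hGN : ∀ N, IsProbabilityMeasure (Gr N) := fun N =>
    isProbabilityMeasure_localGibbsLaw (a₀ := fun _ => (1 : ℝ)) (θ₀ := fun _ => (1 : ℝ))
      (u₀ := fun _ => (0 : V3)) continuous_const continuous_const continuous_const
      (fun _ => one_pos) (fun _ => one_pos) hσ2 N (Φ N)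
  have hfinN : ∀ N : ℕ, klDiv (pt N) (qt N) ≠ ∞ := fun N => (hdec N (Φ N) t ht.1).1
  have hfinq : ∀ N : ℕ, klDiv (qt N) (Gr N) ≠ ∞ := fun N => (hdec N (Φ N) t ht.1).2.1
  -- data processing: `a_N ≥ 0`
  have ha_nonneg : ∀ N : ℕ, 0 ≤ (klDiv (P N) (Gr N)).toReal - (klDiv (qt N) (Gr N)).toReal := by
    intro N
    haveI := hPN N
    haveI := hGN N
    have hle : klDiv (qt N) (Gr N) ≤ klDiv (P N) (Gr N) :=
      klDiv_lambertFlow_le σ N t (P N) (Gr N) (hΛ N)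
        (stub_gibbsInvariance liouvilleInvarianceLambda σ hσ hσhalf N 1 1 0 one_pos one_pos (Φ N) t ht.1)
    have hfinP : klDiv (P N) (Gr N) ≠ ∞ := ne_top_of_le_ne_top ENNReal.ofReal_ne_top (hdec N (Φ N) t ht.1).2.2.2.2.2.2.1
    exact sub_nonneg.2 ((ENNReal.toReal_le_toReal (hfinq N) hfinP).2 hle)
  -- the real sequence `KL(p_t ‖ q_t).toReal/(N+1)` tends to `0`
  have hreal : Tendsto (fun N : ℕ => (klDiv (pt N) (qt N)).toReal / ((N : ℝ) + 1)) atTop (𝓝 0) := by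
    have h := (ENNReal.tendsto_toReal ENNReal.zero_ne_top).comp hlim
    rw [ENNReal.toReal_zero] at h
    refine h.congr fun N => ?_
    simp only [Function.comp_def]
    rw [ENNReal.toReal_div, ENNReal.toReal_add (ENNReal.natCast_ne_top N) ENNReal.one_ne_top,
      ENNReal.toReal_natCast, ENNReal.toReal_one]
  -- `b_N = k_N − a_N ≤ k_N < η` eventually
  have hev := (Metric.tendsto_atTop.1 hreal) η hη
  obtain ⟨N₀, hN₀⟩ := hev
  refine eventually_atTop.2 ⟨N₀, fun N hN => ?_⟩
  have hk := hN₀ N hN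
  rw [Real.dist_eq, sub_zero, abs_lt] at hk
  obtain ⟨-, -, -, -, h5, h6, -, -⟩ := hdec N (Φ N) t ht.1
  have hbk : ((∫ z, llr (qt N) (Gr N) z ∂(qt N)) - ∫ z, llr (qt N) (Gr N) z ∂(pt N)) / ((N : ℝ) + 1) =
      (klDiv (pt N) (qt N)).toReal / ((N : ℝ) + 1) -
        ((klDiv (P N) (Gr N)).toReal - (klDiv (qt N) (Gr N)).toReal) / ((N : ℝ) + 1) := by
    rw [h5, h6]
    ring
  rw [hbk]
  have hdiv : 0 ≤ ((klDiv (P N) (Gr N)).toReal - (klDiv (qt N) (Gr N)).toReal) / ((N : ℝ) + 1) :=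
    div_nonneg (ha_nonneg N) (by positivity)
  linarith [hk.2]

end Summit.AtomisticToContinuum.HydrodynamicLimit.Theorems.LambertianContactSwapSwapGapRelEntSwapOfUpper

end
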